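import Summits.QuantumFields.BalabanUV.InfraRed.StrongCouplingSixteenClassFront
import Summits.QuantumFields.BalabanUV.InfraRed.StrongCouplingSlabAxialClustering
import HarnessLib

/-!
# Strong-coupling fronts for every `SU(N)`, `N ≥ 2`, through the gauge-fixed doors, and the `SU(3)` v1 windows

Observatory of the non-perturbative crossover; no mass-gap claim.

ABSOLUTE RULE of this package: no internally-minted statement enters as a cited fact; every hypothesis is either
kernel-proved in this package or a verbatim quotation of a PUBLISHED theorem with page reference. The manuscript(s)
under audit are not citable for their own disputed steps. Everything below is assembled from kernel theorems of this
package over Mathlib's Haar measure; no literature axiom is invoked.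

WHAT IS NEW HERE (IR-SC gen 14). The three Dobrushin doors built for `SU(2)` in gens 9–13 are all-`N` engines with the
one-link modulus `OneLinkKRModulus N R K` as a free parameter: the single-site door (row constant `18`,
`strongCouplingFront_of_oneLinkKRModulus`, `dlrMassGapAt_of_oneLinkKRModulus`), the weighted staggered-forest door (row
constant `ρ = 14223/1000`, `exponentialClustering_of_frozenW` with the sixteen-class table W4c) and the temporal axial door
on the open-time slab (row constant `14`, `latticeMassGap_of_oneLinkKRModulus_axial`).  Only the final Wilson-unit
bookkeeping was `SU(2)`-specific (the quarter modulus `K₂ = 1/4` is an `SU(2)` theorem).  This leaf files the doors for a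
general modulus and every `N`, and feeds them the tree's HYPOTHESIS-FREE Bakry–Émery modulus `oneLinkKRModulus_SU`
(`K = 1/(1/2 − R)` on the operator-norm ball `R < 1/2`, Shen–Zhu–Zhu's one-link computation, kernel-proved in
`SUNBakryEmeryPoincare`).  With `x = β/N` (`β` the tree coupling, density `exp(β Σ_p Re tr U_p)`; `x` is the 't Hooft
coupling) and `R = 6x`, a door with row constant `D` opens iff `D x /(1/2 − 6x) < 1 ⟺ x < 1/(2(D + 6))`:

* SC-a (DLR uniqueness + clustering, `DLRMassGapAt 4 N x`):          `D = 18`,          `x < 1/48`      (the tree's S16);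
* SC-b (volume-uniform torus front, `StrongCouplingFront`):           `D = 14223/1000`,  `x < 500/20223` (`= 1/40.446`);
* SC-c (slab transfer-operator gap, `LatticeMassGap`, axial gauge):   `D = 14`,          `x < 1/40`      (tree, gen 13).

`SU(3)` v1 IN WILSON UNITS `β_W = 2N/g² = 6/g²` (Wilson action `β_W Σ_p (1 − ⅓ Re tr U_p)`, tree coupling `β = β_W/3`,
't Hooft `x = β_W/9`): **SC-a for `0 ≤ β_W < 3/16 = 0.1875` (`g² > 32`); SC-b for `β_W < 4500/20223 = 0.22251…`
(`g² > 26.964`); SC-c for `0 ≤ β_W < 9/40 = 0.225` (`g² > 80/3`)** — `su3_strongCouplingFronts_v1`, instances at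
`β_W = 0.18` (SC-a) and `β_W = 0.22` (SC-b, SC-c).  All (K)-grade, hypothesis-free.  The printed `SU(3)`, `d = 4` window
is Shen–Zhu–Zhu's `x < 1/48`, i.e. `β_W < 3/16` (CMP 400 (2023), arXiv:2204.12737: Assumption 1.1, Thm. 1.2 and the
Corollary «Mass gap»); SC-b and SC-c exceed it by the factors `48·500/20223 = 1.1868` and `48/40 = 1.2` — the gauge-fixing
levers of gens 10–13, nothing else.

NOT CLAIMED: anything at or above these windows; any `SU(3)` analogue of the `SU(2)` modulus improvements (odd tilt,
exact variance, sharp Poincaré, quarter modulus are `SU(2)` theorems: `SU(2) ≅ S³`); for `SU(2)` the numbers of this leaf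
(`β_W < 1/12`, `2000/20223`, `1/10`) are WEAKER than the filed quarter-modulus windows (`2/9`, `4000/14223`, `2/7`) and are
not filed as fronts; no mass-gap claim.
-/

noncomputable section

open Literature.MathematicalPhysics.QuantumFieldTheory
open Literature.MathematicalPhysics.QuantumLattice (fundamentalRep fundamentalLatticeRep)
open Literature.MathematicalPhysics.QuantumFieldTheory.Balaban1983to89
open Literature.MathematicalPhysics.QuantumFieldTheory.Balaban1983to89.StrongCouplingDobrushinWindow
open Literature.MathematicalPhysics.QuantumFieldTheory.Balaban1983to89.StrongCouplingTorusWindow (krRate krRate_pos)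
open Literature.MathematicalPhysics.QuantumFieldTheory.Balaban1983to89.StrongCouplingKernelWindow
  (oneLinkKRModulus_SU dlrMassGapAt_SU strongCouplingFront_SU)
open Summit.QuantumFields.BalabanUV.InfraRed.StrongCouplingForestGauge
open Summit.QuantumFields.BalabanUV.InfraRed.StrongCouplingStaggerForest
open Summit.QuantumFields.BalabanUV.InfraRed.StrongCouplingWeightedFrozenCovariance (WeightedForestRowBound)
open Summit.QuantumFields.BalabanUV.InfraRed.StrongCouplingWeightedForestDoor (exponentialClustering_of_frozenW)
open Summit.QuantumFields.BalabanUV.InfraRed.StrongCouplingStaggerPhaseWeights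
open Summit.QuantumFields.BalabanUV.InfraRed.StrongCouplingSixteenClassFront (wideU weightedForestRowBound_sixteenClass)
open Summit.QuantumFields.BalabanUV.InfraRed.StrongCouplingSlabAxialClustering
  (latticeMassGap_of_oneLinkKRModulus_axial latticeMassGap_SU_axial)

namespace Summit.QuantumFields.BalabanUV.InfraRed.StrongCouplingSUNFronts

/-! ## 1. The weighted forest door for every `SU(N)` and every modulus -/

/-- **The weighted forest door, general `N` and general modulus** (twin of `su2_weightedForestDoor`): ranked forests
with `WeightedForestRowBound (Fs S) (vs S) ρ`, weights in `[vmin, vmax]`, `0 < vmin`, on the odd tori of side `≥ 2S₀+1`,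
a one-link modulus `OneLinkKRModulus N R K` on a ball `R ≥ 6β₀/N`, and `ρ (β₀/N) K < 1` give the strong-coupling front
`StrongCouplingFront (fundamentalLatticeRep N) β₀` at the rate `krRate (ρ (β₀/N) K)`.
[cite: Follmer1988, Ch. I Theorem (2.13)] [cite: Georgii2011, Thm. 8.7, Thm. 8.20, Remark 8.26, §8.2] -/
theorem strongCouplingFront_of_oneLinkKRModulus_weighted {N : ℕ} (hN : 1 ≤ N) {ρ vmin vmax : ℝ} (hρ0 : 0 ≤ ρ)
    (hvmin : 0 < vmin)
    (Fs : (S : ℕ) → Finset (Edge 4 (2 * S + 1))) (rks : (S : ℕ) → Site 4 (2 * S + 1) → ℕ)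
    (vs : (S : ℕ) → Edge 4 (2 * S + 1) → ℝ) (S₀ : ℕ)
    (hforest : ∀ S, S₀ ≤ S → IsRankedForest (Fs S) (rks S) ∧ WeightedForestRowBound (Fs S) (vs S) ρ ∧
      (∀ y, vmin ≤ vs S y) ∧ ∀ y, vs S y ≤ vmax)
    {β₀ R K : ℝ} (hK : 0 ≤ K) (hR : β₀ / N * 6 ≤ R) (hmod : OneLinkKRModulus N R K)
    (hsmall : ρ * (β₀ / N) * K < 1) :
    CrossoverLedger.StrongCouplingFront (fundamentalLatticeRep N) β₀ := by
  have hN0 : (0 : ℝ) < N := by exact_mod_cast (show 0 < N by omega)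
  refine ⟨krRate (ρ * (β₀ / N) * K), krRate_pos hsmall, fun β hβ0 hββ₀ => ?_⟩
  have hβabs : |β| = β := abs_of_nonneg hβ0
  have hdiv : β / N ≤ β₀ / N := div_le_div_of_nonneg_right hββ₀ hN0.le
  refine exponentialClustering_of_frozenW hN hρ0 hvmin Fs rks vs S₀ hforest hK (R := R) ?_ hmod ?_ hsmall
  · rw [hβabs]; linarith
  · rw [hβabs]
    have : ρ * (β / N) * K ≤ ρ * (β₀ / N) * K :=
      mul_le_mul_of_nonneg_right (mul_le_mul_of_nonneg_left hdiv hρ0) hK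
    exact this

/-- **The sixteen-class weighted staggered-forest door, general `N` and general modulus** (row constant
`ρ = 14223/1000`, table W4c of `StrongCouplingSixteenClassFront`, odd tori of side `≥ 23`): a modulus on the ball
`R ≥ 6β₀/N` with `(14223/1000) (β₀/N) K < 1` gives `StrongCouplingFront (fundamentalLatticeRep N) β₀`. [folklore] -/
theorem strongCouplingFront_of_oneLinkKRModulus_sixteenClass {N : ℕ} (hN : 1 ≤ N) {β₀ R K : ℝ} (hK : 0 ≤ K)
    (hR : β₀ / N * 6 ≤ R) (hmod : OneLinkKRModulus N R K) (hsmall : 14223 / 1000 * (β₀ / N) * K < 1) :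
    CrossoverLedger.StrongCouplingFront (fundamentalLatticeRep N) β₀ :=
  strongCouplingFront_of_oneLinkKRModulus_weighted hN (ρ := 14223 / 1000) (vmin := 1) (vmax := 936 / 625)
    (by norm_num) (by norm_num) (fun S => staggerForest (2 * S + 1)) (fun _ => stagRank)
    (fun _ => phaseWeight wideU (12521 / 10000)) 11
    (fun S hS => ⟨isRankedForest_stagger (by omega), weightedForestRowBound_sixteenClass (by omega)⟩) hK hR hmod hsmall

/-! ## 2. The three doors fed with the Bakry–Émery modulus: every `SU(N)`, `N ≥ 2`, hypothesis-free -/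

/-- **SC-b for every `SU(N)`, `N ≥ 2`, below `β = 500N/20223` (tree coupling; 't Hooft `β/N < 500/20223 = 1/40.446`),
hypothesis-free**: the sixteen-class weighted forest door with `K = 1/(1/2 − 6β/N)` from `oneLinkKRModulus_SU`;
`(14223/1000) x/(1/2 − 6x) < 1 ⟺ x < 500/20223`.  Improves the tree's un-gauged `strongCouplingFront_SU` (`β < N/48`) by the
factor `24000/20223 = 1.1868`. [cite: arXiv220412737, Lemma 4.1 with (4.4)-(4.6) and Rem. 1.3] -/
theorem strongCouplingFront_SU_sixteenClass {N : ℕ} (hN : 2 ≤ N) {β₀ : ℝ} (hβ : β₀ < N * (500 / 20223)) :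
    CrossoverLedger.StrongCouplingFront (fundamentalLatticeRep N) β₀ := by
  have hN0 : (0 : ℝ) < N := by exact_mod_cast (show 0 < N by omega)
  have hx : β₀ / N < 500 / 20223 := by
    rw [div_lt_iff₀ hN0]
    linarith
  have hRlt : β₀ / N * 6 < 1 / 2 := by linarith
  have hpos : 0 < 1 / 2 - β₀ / N * 6 := by linarith
  refine strongCouplingFront_of_oneLinkKRModulus_sixteenClass (by omega) (R := β₀ / N * 6)
    (K := 1 / (1 / 2 - β₀ / N * 6)) (one_div_pos.2 hpos).le le_rfl (oneLinkKRModulus_SU hN hRlt) ?_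
  rw [← mul_div_assoc, mul_one, div_lt_one hpos]
  linarith

/-- **The three hypothesis-free strong-coupling windows of `SU(N)`, `N ≥ 2`, `d = 4`, in one theorem** (tree coupling
`β ≥ 0`, density `exp(β Σ_p Re tr U_p)`, 't Hooft coupling `β/N`): SC-a (`DLRMassGapAt 4 N (β/N)`, single-site door,
row constant `18`) below `β = N/48`; SC-b (`StrongCouplingFront`, sixteen-class weighted forest door, `14223/1000`) below
`β = 500N/20223`; SC-c (`LatticeMassGap`, temporal axial door on the open-time slab, `14`) below `β = N/40`, at the rate
`krRate (14 (β/N)/(1/2 − 6β/N))`.  Modulus: Bakry–Émery, `K = 1/(1/2 − 6β/N)`.  Observatory of the non-perturbative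
crossover; no mass-gap claim. [cite: arXiv220412737, Assumption 1.1, Thm. 1.2, Lemma 4.1, Cor. Mass gap] -/
theorem strongCouplingFronts_SU {N : ℕ} (hN : 2 ≤ N) {β : ℝ} (h0 : 0 ≤ β) :
    (β < N / 48 → DLRMassGapAt 4 N (β / N)) ∧
      (β < N * (500 / 20223) → CrossoverLedger.StrongCouplingFront (fundamentalLatticeRep N) β) ∧
        (β < N / 40 →
          CrossoverLedger.LatticeMassGap (fundamentalRep (Fin N)) β
            (krRate (14 * (β / N) * (1 / (1 / 2 - β / N * 6))))) := by
  have hN0 : (0 : ℝ) < N := by exact_mod_cast (show 0 < N by omega)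
  refine ⟨fun h => ?_, fun h => strongCouplingFront_SU_sixteenClass hN h, fun h => latticeMassGap_SU_axial hN h0 h⟩
  refine dlrMassGapAt_SU (d := 4) (N := N) (by norm_num) hN ?_
  rw [abs_of_nonneg (div_nonneg h0 hN0.le), div_lt_iff₀ hN0]
  push_cast
  linarith

/-- The 't Hooft thresholds of the three Bakry–Émery doors side by side: `1/48 < 500/20223 < 1/40`, each of the form
`1/(2(D+6))` for `D = 18, 14223/1000, 14`. [folklore] -/
theorem bakryEmeryDoors_numbers :
    (1 : ℝ) / 48 = 1 / (2 * (18 + 6)) ∧ (500 : ℝ) / 20223 = 1 / (2 * (14223 / 1000 + 6)) ∧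
      (1 : ℝ) / 40 = 1 / (2 * (14 + 6)) ∧ (1 : ℝ) / 48 < 500 / 20223 ∧ (500 : ℝ) / 20223 < 1 / 40 := by
  norm_num

/-! ## 3. `SU(3)` v1 in Wilson units `β_W = 6/g²` -/

/-- **`SU(3)` v1 — the three hypothesis-free strong-coupling windows in Wilson units** `β_W = 2N/g² = 6/g²` (Wilson
action `β_W Σ_p (1 − ⅓ Re tr U_p)`; tree coupling `β_W/3`; 't Hooft coupling `β_W/9`): SC-a (`DLRMassGapAt 4 3 (β_W/9)`)
below `β_W = 3/16 = 0.1875`; SC-b (`StrongCouplingFront (fundamentalLatticeRep 3) (β_W/3)`) below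
`β_W = 4500/20223 = 0.22251…`; SC-c (`LatticeMassGap (fundamentalRep (Fin 3)) (β_W/3) (krRate (14 (β_W/9)/(1/2 − 6 β_W/9)))`)
below `β_W = 9/40 = 0.225`.  Bakry–Émery modulus throughout.  Observatory of the non-perturbative crossover; no mass-gap
claim. [cite: arXiv220412737, Assumption 1.1, Thm. 1.2, Lemma 4.1, Cor. Mass gap] -/
theorem su3_strongCouplingFronts_v1 {βW : ℝ} (h0 : 0 ≤ βW) :
    (βW < 3 / 16 → DLRMassGapAt 4 3 (βW / 9)) ∧
      (βW < 4500 / 20223 → CrossoverLedger.StrongCouplingFront (fundamentalLatticeRep 3) (βW / 3)) ∧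
        (βW < 9 / 40 →
          CrossoverLedger.LatticeMassGap (fundamentalRep (Fin 3)) (βW / 3)
            (krRate (14 * (βW / 9) * (1 / (1 / 2 - βW / 9 * 6))))) := by
  obtain ⟨ha, hb, hc⟩ := strongCouplingFronts_SU (N := 3) (by norm_num) (β := βW / 3) (by positivity)
  have e9 : βW / 3 / ((3 : ℕ) : ℝ) = βW / 9 := by push_cast; ring
  refine ⟨fun h => ?_, fun h => hb ?_, fun h => ?_⟩
  · have := ha (by push_cast; linarith)
    rwa [e9] at this
  · push_cast; linarith
  · have := hc (by push_cast; linarith)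
    rwa [e9] at this

/-- **SC-a for `SU(3)` below `β_W = 3/16`** (= the printed Shen–Zhu–Zhu window `x < 1/48` in Wilson units).
[cite: arXiv220412737, Assumption 1.1, Thm. 1.2, Cor. Mass gap] -/
theorem su3_dlrMassGapAt_lt {βW : ℝ} (h0 : 0 ≤ βW) (h : βW < 3 / 16) : DLRMassGapAt 4 3 (βW / 9) :=
  (su3_strongCouplingFronts_v1 h0).1 h

/-- **SC-b for `SU(3)` below `β_W = 4500/20223 = 0.22251…`, hypothesis-free** (vacuous for `β_W < 0`). [folklore] -/
theorem su3_strongCouplingFront_lt {βW : ℝ} (h : βW < 4500 / 20223) :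
    CrossoverLedger.StrongCouplingFront (fundamentalLatticeRep 3) (βW / 3) :=
  strongCouplingFront_SU_sixteenClass (N := 3) (by norm_num) (by push_cast; linarith)

/-- **SC-c for `SU(3)` below `β_W = 9/40 = 0.225`, hypothesis-free.** [folklore] -/
theorem su3_latticeMassGap_lt {βW : ℝ} (h0 : 0 ≤ βW) (h : βW < 9 / 40) :
    CrossoverLedger.LatticeMassGap (fundamentalRep (Fin 3)) (βW / 3)
      (krRate (14 * (βW / 9) * (1 / (1 / 2 - βW / 9 * 6)))) :=
  (su3_strongCouplingFronts_v1 h0).2.2 h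

/-- Instance: **SC-a for `SU(3)` AT `β_W = 0.18`** (`g² = 33.3…`). [folklore] -/
theorem su3_dlrMassGapAt_018 : DLRMassGapAt 4 3 ((18 / 100 : ℝ) / 9) :=
  su3_dlrMassGapAt_lt (by norm_num) (by norm_num)

/-- Instance: **SC-b for `SU(3)` AT `β_W = 0.22`** (tree coupling `0.0733…`, `g² = 27.27…`). [folklore] -/
theorem su3_strongCouplingFront_022 :
    CrossoverLedger.StrongCouplingFront (fundamentalLatticeRep 3) ((22 / 100 : ℝ) / 3) :=
  su3_strongCouplingFront_lt (by norm_num)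

/-- Instance: **SC-c for `SU(3)` AT `β_W = 0.22`**. [folklore] -/
theorem su3_latticeMassGap_022 :
    CrossoverLedger.LatticeMassGap (fundamentalRep (Fin 3)) ((22 / 100 : ℝ) / 3)
      (krRate (14 * ((22 / 100 : ℝ) / 9) * (1 / (1 / 2 - (22 / 100 : ℝ) / 9 * 6)))) :=
  su3_latticeMassGap_lt (by norm_num) (by norm_num)

/-- **`SU(3)` in the bare coupling** `g² = 6/β_W`: SC-a for `g² > 32`, SC-b for `g² > 20223/750 = 26.964`, SC-c for
`g² > 80/3 = 26.67`. [folklore] -/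
theorem su3_strongCouplingFronts_of_bareCoupling {gsq : ℝ} (hg : 0 < gsq) :
    (32 < gsq → DLRMassGapAt 4 3 ((6 / gsq) / 9)) ∧
      (20223 / 750 < gsq → CrossoverLedger.StrongCouplingFront (fundamentalLatticeRep 3) ((6 / gsq) / 3)) ∧
        (80 / 3 < gsq →
          CrossoverLedger.LatticeMassGap (fundamentalRep (Fin 3)) ((6 / gsq) / 3)
            (krRate (14 * ((6 / gsq) / 9) * (1 / (1 / 2 - (6 / gsq) / 9 * 6))))) := by
  obtain ⟨ha, hb, hc⟩ := su3_strongCouplingFronts_v1 (βW := 6 / gsq) (by positivity)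
  refine ⟨fun h => ha ?_, fun h => hb ?_, fun h => hc ?_⟩ <;> rw [div_lt_iff₀ hg] <;> linarith

/-- The `SU(3)` numbers side by side: `3/16 < 0.22 < 4500/20223 < 9/40`; the gains over the printed `3/16`:
`(4500/20223)/(3/16) = 24000/20223` and `(9/40)/(3/16) = 6/5`. [folklore] -/
theorem su3_window_numbers :
    (3 : ℝ) / 16 < 22 / 100 ∧ (22 : ℝ) / 100 < 4500 / 20223 ∧ (4500 : ℝ) / 20223 < 9 / 40 ∧
      (4500 : ℝ) / 20223 / (3 / 16) = 24000 / 20223 ∧ (9 : ℝ) / 40 / (3 / 16) = 6 / 5 := by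
  norm_num

end Summit.QuantumFields.BalabanUV.InfraRed.StrongCouplingSUNFronts
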